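import Mathlib
import HarnessLib
import Literature.NumberTheory.LFunctions.RiemannXiProofs
import Literature.NumberTheory.LFunctions.ZetaZerosProofs
import Summits.RiemannHypothesis.RiemannHypothesis.Theorems.Splittings.EarlyAppointmentsXiZetaDictionary

/-!
# Window reindexing for riemannXiUpper zeros

This file provides the finsum↔Finset.sum reindexing lemma connecting:
- The **distance-based** window `{u : ℂ | riemannXiUpper u = 0 ∧ |u.re − x| < R}` for `Ξ` zeros
- The Finset form for summation

For a zero `u` of `Ξ = riemannXiUpper` (i.e., `Ξ(u) = ξ(1/2 + I·u) = 0`), the zero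
`ρ := 1/2 + I·u` of `ξ` (equivalently of `ζ` in the critical strip) satisfies:
- `Im ρ = u.re`
- `Re ρ = 1/2 − u.im`

The finiteness follows from `xiZerosWindowFinite_holds` in the tree.

## Main Results

- `xiWindowZeros_finite`: The distance window for `Ξ` zeros is finite
- `finsum_xiWindow_eq_finset_sum`: Reindex finsum over distance window to Finset.sum

Nothing here bears on the truth of RH; RH is not proved.
-/

set_option linter.dupNamespace false

noncomputable section

open Filter Set Topology Complex
open scoped BigOperators
open Literature.NumberTheory.LFunctions
open Summit.RiemannHypothesis.RiemannHypothesis.Theorems.Splittings.EarlyAppointmentsXiZetaDictionary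

namespace Summit.RiemannHypothesis.RiemannHypothesis.Theorems.WindowReindex

/-! ## The distance-based window of Ξ zeros -/

/-- The set of `Ξ` zeros within distance `R` of `x` (by real part). -/
def xiWindowZeros (x R : ℝ) : Set ℂ :=
  {u : ℂ | riemannXiUpper u = 0 ∧ |u.re - x| < R}

/-- Map from `Ξ` zeros to `ζ` zeros: `u ↦ 1/2 + I·u`. -/
def toZetaZero (u : ℂ) : ℂ := 1 / 2 + I * u

/-- Inverse map: `ρ ↦ −I·(ρ − 1/2)`. -/
def fromZetaZero (ρ : ℂ) : ℂ := -I * (ρ - 1 / 2)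

/-- `toZetaZero` and `fromZetaZero` are inverses (right inverse). -/
theorem toZetaZero_fromZetaZero (ρ : ℂ) : toZetaZero (fromZetaZero ρ) = ρ := by
  simp only [toZetaZero, fromZetaZero]
  have hI : I * I = -1 := Complex.I_mul_I
  linear_combination (-(ρ - 1 / 2)) * hI

/-- `toZetaZero` and `fromZetaZero` are inverses (left inverse). -/
theorem fromZetaZero_toZetaZero (u : ℂ) : fromZetaZero (toZetaZero u) = u := by
  simp only [toZetaZero, fromZetaZero]
  have hI : I * I = -1 := Complex.I_mul_I
  linear_combination -u * hI

/-- The imaginary part of `toZetaZero u` equals the real part of `u`. -/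
theorem toZetaZero_im (u : ℂ) : (toZetaZero u).im = u.re := by
  simp [toZetaZero]

/-- The real part of `toZetaZero u` equals `1/2 - u.im`. -/
theorem toZetaZero_re (u : ℂ) : (toZetaZero u).re = 1 / 2 - u.im := by
  simp [toZetaZero, sub_eq_add_neg]

/-- The real part of `fromZetaZero ρ` equals the imaginary part of `ρ`. -/
theorem fromZetaZero_re (ρ : ℂ) : (fromZetaZero ρ).re = ρ.im := by
  simp [fromZetaZero]

/-- The imaginary part of `fromZetaZero ρ` equals `1/2 - ρ.re`. -/
theorem fromZetaZero_im (ρ : ℂ) : (fromZetaZero ρ).im = 1 / 2 - ρ.re := by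
  simp [fromZetaZero]

/-- The distance-based window of `Ξ` zeros is finite.
Uses `xiZerosWindowFinite_holds` from the tree: `{u | Ξ u = 0 ∧ a ≤ u.re ≤ b}` is finite. -/
theorem xiWindowZeros_finite (x R : ℝ) : (xiWindowZeros x R).Finite := by
  refine (xiZerosWindowFinite_holds (x - R) (x + R)).subset ?_
  intro u hu
  simp only [xiWindowZeros, mem_setOf_eq] at hu
  obtain ⟨h0, hdist⟩ := hu
  rw [abs_lt] at hdist
  exact ⟨h0, by linarith, by linarith⟩

/-! ## The reindexing lemma -/

/-- Finset of `Ξ` zeros in the distance window. -/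
def xiWindowFinset (x R : ℝ) : Finset ℂ := (xiWindowZeros_finite x R).toFinset

/-- Membership in `xiWindowFinset` is equivalent to membership in `xiWindowZeros`. -/
theorem mem_xiWindowFinset {x R : ℝ} {u : ℂ} :
    u ∈ xiWindowFinset x R ↔ u ∈ xiWindowZeros x R :=
  Set.Finite.mem_toFinset _

/-- The finsum over the distance window equals the Finset.sum over `xiWindowFinset`. -/
theorem finsum_xiWindow_eq_finset_sum {M : Type*} [AddCommMonoid M] (x R : ℝ) (f : ℂ → M) :
    ∑ᶠ u ∈ xiWindowZeros x R, f u = ∑ u ∈ xiWindowFinset x R, f u := by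
  rw [finsum_mem_eq_finite_toFinset_sum f (xiWindowZeros_finite x R)]
  rfl

end Summit.RiemannHypothesis.RiemannHypothesis.Theorems.WindowReindex
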